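import Literature.Analysis.ODE.CompactSupportFlow
import Mathlib.Analysis.ODE.Gronwall
import HarnessLib

/-!
# The global flow of a globally Lipschitz (time-independent) vector field

Topic `Literature/Analysis/ODE` (namespace `Literature.Analysis.ODE`).  Sequel to
`CompactSupportFlow.lean`, whose `Literature.Analysis.ODE.globalFlow` requires the field to be
globally Lipschitz **and bounded**; here the boundedness is dropped: a globally `K`-Lipschitz
field `g` on a Banach space has linear growth `‖g x‖ ≤ ‖g 0‖ + K ‖x‖`, so Grönwall's
majorisation bounds every solution a priori on bounded time intervals and the continuation
principle (`Literature.Analysis.ODE.exists_solution_Ici_of_apriori_bound`) gives integral curves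
on all of `ℝ` (Hartman, *Ordinary Differential Equations*, Ch. III, Thm. 5.1 — Wintner's
global existence under `|f| ≤ ψ(|y|)`, `∫ du/ψ = ∞`, Remark 1: `ψ(u) = Cu` —; Teschl, Cor. 2.16;
Lang, *Differential and Riemannian Manifolds*, Ch. IV §1: Thm. 1.3 uniqueness, Lemma 1.15 group
law, Thm. 1.16 smooth dependence).  Everything here is **proved**; no named facts:

* `Literature.Analysis.ODE.exists_solution_real_of_lipschitz` — two-sided global existence;
* `Literature.Analysis.ODE.lipschitzFlow hK : F → ℝ → F` — the resulting **global flow** with its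
  API `lipschitzFlow_zero`, `hasDerivAt_lipschitzFlow`, uniqueness `eqOn_lipschitzFlow`, the
  group law `lipschitzFlow_add`, `lipschitzFlow_neg_lipschitzFlow`, joint smoothness
  `contDiff_lipschitzFlow` for `C^n` fields (`n ≥ 1`), `lipschitzFlow_eq_self_of_eq_zero`;
* `Literature.Analysis.ODE.globalFlow_eq_lipschitzFlow` — for a bounded Lipschitz field the two
  flows agree (so `globalFlow` is the special case; it is to be rebased on `lipschitzFlow` in a
  later refactor, its users being `CompactSupportFlow.lean` itself and `TorusBackwardFlow.lean`).

The application in `Literature/Topology/FourManifolds/` is the global flow of Milnor's model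
field `η⃗` of the First Cancellation Theorem (linear in all but one coordinate, hence unbounded).

## References

* P. Hartman, *Ordinary Differential Equations*, Classics in Applied Mathematics 38 (SIAM 2002),
  Ch. III §5, Thm. 5.1 and Remark 1 (PDF p. 38 of the held copy
  `book:hartman2002-ordinary-differential-equations`). [Hartman2002]
* S. Lang, *Differential and Riemannian Manifolds*, GTM 160 (1995), Ch. IV §1, Thm. 1.3,
  Lemma 1.15, Thm. 1.16. [Lang1995]
* G. Teschl, *Ordinary Differential Equations and Dynamical Systems*, GSM 140 (2012), Cor. 2.16.
  [Teschl2012]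
-/

noncomputable section

open Set Metric Filter Topology Function
open scoped ContDiff NNReal

namespace Literature.Analysis.ODE

universe u

section Lipschitz

variable {F : Type u} [NormedAddCommGroup F] [NormedSpace ℝ F]

variable [CompleteSpace F]

/-- **Forward global existence** for a globally Lipschitz (time-independent) field: a solution
on `[0, ∞)` through every point (`exists_solution_Ici_of_apriori_bound` with Grönwall's a priori
bound from the linear growth `‖g x‖ ≤ K ‖x‖ + ‖g 0‖`). [cite: Hartman2002, Ch. III, Thm. 5.1 with Remark 1 (PDF p. 38); Teschl2012, Cor. 2.16] -/
theorem exists_solution_Ici_of_lipschitz {g : F → F} {K : ℝ≥0} (hK : LipschitzWith K g)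
    (q₀ : F) :
    ∃ α : ℝ → F, α 0 = q₀ ∧ (∀ t, 0 ≤ t → HasDerivWithinAt α (g (α t)) (Ici 0) t) ∧
      ∀ t, 0 < t → HasDerivAt α (g (α t)) t := by
  have hgrowth : ∀ x, ‖g x‖ ≤ K * ‖x‖ + ‖g 0‖ := fun x => by
    have h1 : ‖g x - g 0‖ ≤ K * ‖x‖ := by
      have := hK.norm_sub_le x 0
      rwa [sub_zero] at this
    calc ‖g x‖ = ‖(g x - g 0) + g 0‖ := by rw [sub_add_cancel]
      _ ≤ ‖g x - g 0‖ + ‖g 0‖ := norm_add_le _ _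
      _ ≤ K * ‖x‖ + ‖g 0‖ := by linarith
  have hmono : Monotone (gronwallBound ‖q₀‖ K ‖g 0‖) :=
    gronwallBound_mono (norm_nonneg q₀) (norm_nonneg (g 0)) K.coe_nonneg
  have hapriori : ∀ T : ℝ, 0 ≤ T → ∃ R : ℝ, ‖q₀‖ ≤ R ∧ ∀ s ∈ Icc 0 T, ∀ β : ℝ → F, β 0 = q₀ →
      (∀ t ∈ Icc 0 s, HasDerivWithinAt β (g (β t)) (Icc 0 s) t) → ∀ t ∈ Icc 0 s, ‖β t‖ ≤ R := by
    intro T hT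
    refine ⟨gronwallBound ‖q₀‖ K ‖g 0‖ T, ?_, fun s hs β hβ0 hβ t ht => ?_⟩
    · have := hmono hT
      rwa [gronwallBound_x0] at this
    · have hcont : ContinuousOn β (Icc 0 s) := fun τ hτ => (hβ τ hτ).continuousWithinAt
      have hder : ∀ τ ∈ Ico 0 s, HasDerivWithinAt β (g (β τ)) (Ici τ) τ := fun τ hτ =>
        (hβ τ (Ico_subset_Icc_self hτ)).mono_of_mem_nhdsWithin
          (mem_of_superset (Icc_mem_nhdsGE hτ.2) (Icc_subset_Icc hτ.1 le_rfl))
      have h := norm_le_gronwallBound_of_norm_deriv_right_le hcont hder (le_of_eq (by rw [hβ0]))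
        (fun τ _ => hgrowth (β τ)) t ht
      rw [sub_zero] at h
      refine h.trans ?_
      exact hmono (ht.2.trans hs.2)
  obtain ⟨α, h0, -, hIci, hpos⟩ := exists_solution_Ici_of_apriori_bound (v := fun _ => g)
    (x₀ := q₀) (fun _ _ => ⟨K, fun _ _ => hK.lipschitzOnWith⟩) (fun _ => continuousOn_const)
    hapriori
  exact ⟨α, h0, hIci, hpos⟩

/-- **Global existence on `ℝ`** for a globally Lipschitz time-independent vector field on a
Banach space: through every point passes an integral curve defined for all times (forward
solution of `g` and of `-g`, glued at `t = 0`). [cite: Hartman2002, Ch. III, Thm. 5.1 with Remark 1 (PDF p. 38); Teschl2012, Cor. 2.16] -/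
theorem exists_solution_real_of_lipschitz {g : F → F} {K : ℝ≥0} (hK : LipschitzWith K g)
    (q₀ : F) : ∃ α : ℝ → F, α 0 = q₀ ∧ ∀ t, HasDerivAt α (g (α t)) t := by
  obtain ⟨αp, h0p, hIcip, hposp⟩ := exists_solution_Ici_of_lipschitz hK q₀
  have hKn : LipschitzWith K fun q => -g q := by
    refine LipschitzWith.of_dist_le_mul fun x y => ?_
    rw [dist_neg_neg]
    exact hK.dist_le_mul x y
  obtain ⟨αm, h0m, hIcim, hposm⟩ := exists_solution_Ici_of_lipschitz hKn q₀
  refine ⟨fun t => if 0 ≤ t then αp t else (αm ∘ Neg.neg) t, by simp [h0p], fun t => ?_⟩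
  show HasDerivAt _ (g (if 0 ≤ t then αp t else (αm ∘ Neg.neg) t)) t
  rcases lt_trichotomy t 0 with ht | rfl | ht
  · have hev : (fun s => if 0 ≤ s then αp s else (αm ∘ Neg.neg) s) =ᶠ[𝓝 t] (αm ∘ Neg.neg) := by
      filter_upwards [Iio_mem_nhds ht] with s hs
      rw [if_neg (not_le.2 hs)]
    have hd : HasDerivAt (αm ∘ Neg.neg) (g ((αm ∘ Neg.neg) t)) t := by
      have h1 := hposm (-t) (by linarith)
      have h2 := h1.scomp t (hasDerivAt_neg (x := t))
      rwa [neg_smul, one_smul, neg_neg] at h2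
    rw [if_neg (not_le.2 ht)]
    exact hd.congr_of_eventuallyEq hev
  · rw [if_pos le_rfl, h0p]
    have hr : HasDerivWithinAt (fun s => if 0 ≤ s then αp s else (αm ∘ Neg.neg) s) (g q₀)
        (Ici 0) 0 := by
      have h1 := hIcip 0 le_rfl
      rw [h0p] at h1
      exact h1.congr (fun s hs => by rw [if_pos (mem_Ici.1 hs)]) (by simp [h0p])
    have hl : HasDerivWithinAt (fun s => if 0 ≤ s then αp s else (αm ∘ Neg.neg) s) (g q₀)
        (Iic 0) 0 := by
      have h1 := hIcim 0 le_rfl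
      rw [h0m] at h1
      have h2 : HasDerivWithinAt (αm ∘ Neg.neg) ((-1 : ℝ) • -g q₀) (Iic 0) 0 :=
        h1.scomp_of_eq (0 : ℝ) (hasDerivWithinAt_neg (x := (0 : ℝ)) (s := Iic 0))
          (fun s hs => mem_Ici.2 (neg_nonneg.2 (mem_Iic.1 hs))) neg_zero.symm
      rw [neg_smul, one_smul, neg_neg] at h2
      refine h2.congr (fun s hs => ?_) (by simp [h0p, h0m])
      rcases (mem_Iic.1 hs).lt_or_eq with hs' | rfl
      · rw [if_neg (not_le.2 hs')]
      · simp [h0p, h0m]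
    have := hl.union hr
    rwa [Iic_union_Ici, hasDerivWithinAt_univ] at this
  · have hev : (fun s => if 0 ≤ s then αp s else (αm ∘ Neg.neg) s) =ᶠ[𝓝 t] αp := by
      filter_upwards [Ioi_mem_nhds ht] with s hs
      rw [if_pos (le_of_lt hs)]
    rw [if_pos ht.le]
    exact (hposp t ht).congr_of_eventuallyEq hev

/-! ### The global flow -/

variable {g : F → F} {K : ℝ≥0}

/-- The **global flow** `Ψ q t` of a globally Lipschitz vector field `g` (the integral curve
through `q` at time `0`, evaluated at time `t`; a definition by choice, characterised by
`lipschitzFlow_zero`, `hasDerivAt_lipschitzFlow` and uniqueness `eqOn_lipschitzFlow`).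
[cite: Lang1995, Ch. IV §1, Thm. 1.16] -/
def lipschitzFlow (hK : LipschitzWith K g) (q : F) : ℝ → F :=
  (exists_solution_real_of_lipschitz hK q).choose

/-- The global flow starts at `q`. [folklore] -/
@[simp]
theorem lipschitzFlow_zero (hK : LipschitzWith K g) (q : F) : lipschitzFlow hK q 0 = q :=
  (exists_solution_real_of_lipschitz hK q).choose_spec.1

/-- The global flow consists of integral curves. [folklore] -/
theorem hasDerivAt_lipschitzFlow (hK : LipschitzWith K g) (q : F) (t : ℝ) :
    HasDerivAt (lipschitzFlow hK q) (g (lipschitzFlow hK q t)) t :=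
  (exists_solution_real_of_lipschitz hK q).choose_spec.2 t

/-- The curves of the global flow are continuous. [folklore] -/
theorem continuous_lipschitzFlow (hK : LipschitzWith K g) (q : F) :
    Continuous (lipschitzFlow hK q) :=
  continuous_iff_continuousAt.2 fun t => (hasDerivAt_lipschitzFlow hK q t).continuousAt

/-- **Uniqueness**: an integral curve on an open interval containing `0` is the flow curve of
its value at `0` (Lang (1995), IV §1, Thm. 1.3). [cite: Lang1995, Ch. IV §1, Thm. 1.3] -/
theorem eqOn_lipschitzFlow (hK : LipschitzWith K g) {γ : ℝ → F} {a b : ℝ}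
    (h0 : (0 : ℝ) ∈ Ioo a b) (hγ : ∀ t ∈ Ioo a b, HasDerivAt γ (g (γ t)) t) :
    EqOn γ (lipschitzFlow hK (γ 0)) (Ioo a b) :=
  eqOn_Ioo_of_hasDerivAt isOpen_univ (hK.locallyLipschitz.locallyLipschitzOn) h0 hγ
    (fun _ _ => mem_univ _) (fun t _ => hasDerivAt_lipschitzFlow hK _ t) (by simp)

/-- Uniqueness with the initial condition at an arbitrary time `t₀`: an integral curve on an
open interval through `t₀` is the flow curve of its value at `t₀`, shifted. [cite: Lang1995, Ch. IV §1, Thm. 1.3] -/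
theorem eq_lipschitzFlow_of_hasDerivAt (hK : LipschitzWith K g) {γ : ℝ → F} {a b t₀ : ℝ}
    (ht₀ : t₀ ∈ Ioo a b) (hγ : ∀ t ∈ Ioo a b, HasDerivAt γ (g (γ t)) t) {t : ℝ}
    (ht : t ∈ Ioo a b) : γ t = lipschitzFlow hK (γ t₀) (t - t₀) := by
  have h := eqOn_lipschitzFlow hK (γ := fun s => γ (s + t₀)) (a := a - t₀) (b := b - t₀)
    ⟨by linarith [ht₀.1], by linarith [ht₀.2]⟩
    (fun s hs => (hγ (s + t₀) ⟨by linarith [hs.1], by linarith [hs.2]⟩).comp_add_const s t₀)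
  have h2 := h (x := t - t₀) ⟨by linarith [ht.1], by linarith [ht.2]⟩
  simp only [sub_add_cancel, zero_add] at h2
  exact h2

/-- **The group law** `Ψ q (s + t) = Ψ (Ψ q s) t` of the global flow (Lang (1995), IV §1,
Lemma 1.15). [cite: Lang1995, Ch. IV §1, Lemma 1.15 (PDF p. 71)] -/
theorem lipschitzFlow_add (hK : LipschitzWith K g) (q : F) (s t : ℝ) :
    lipschitzFlow hK q (s + t) = lipschitzFlow hK (lipschitzFlow hK q s) t := by
  set T : ℝ := |s| + |t| + 1 with hT
  have hs : s ∈ Ioo (-T) T := by constructor <;> cases abs_cases s <;> linarith [abs_nonneg t]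
  have ht : t ∈ Ioo (-T) T := by constructor <;> cases abs_cases t <;> linarith [abs_nonneg s]
  have hst : s + t ∈ Ioo (-T) T := by
    constructor <;> cases abs_cases s <;> cases abs_cases t <;> linarith
  exact flow_add_of_hasDerivAt (f := g) (U := univ) (V := univ) isOpen_univ
    hK.locallyLipschitz.locallyLipschitzOn (Φ := lipschitzFlow hK) (T := T)
    (fun q _ => lipschitzFlow_zero hK q) (fun q _ t _ => hasDerivAt_lipschitzFlow hK q t)
    (fun _ _ _ _ => mem_univ _) (mem_univ q) hs (mem_univ _) ht hst

/-- The time-`t` and time-`(-t)` maps of the global flow are inverse to each other. [folklore] -/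
theorem lipschitzFlow_neg_lipschitzFlow (hK : LipschitzWith K g) (q : F) (t : ℝ) :
    lipschitzFlow hK (lipschitzFlow hK q t) (-t) = q := by
  rw [← lipschitzFlow_add, add_neg_cancel, lipschitzFlow_zero]

/-- **Smoothness of the global flow**, jointly in the initial point and time, for a `C^n` field,
`n ≥ 1` (Lang (1995), IV §1, Thm. 1.16, via `contDiffOn_flow_of_hasDerivAt`).
[cite: Lang1995, Ch. IV §1, Thm. 1.16] -/
theorem contDiff_lipschitzFlow {n : ℕ∞} (hg : ContDiff ℝ n g) (hn : 1 ≤ n)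
    (hK : LipschitzWith K g) : ContDiff ℝ n fun p : F × ℝ => lipschitzFlow hK p.1 p.2 := by
  refine contDiff_iff_contDiffAt.2 fun p => ?_
  set T : ℝ := |p.2| + 1 with hT
  have hmem : p ∈ (univ : Set F) ×ˢ Ioo (-T) T :=
    ⟨mem_univ _, by constructor <;> cases abs_cases p.2 <;> linarith⟩
  have h := contDiffOn_flow_of_hasDerivAt (f := g) (U := univ) isOpen_univ hg.contDiffOn hn
    (Φ := lipschitzFlow hK) (V := univ) isOpen_univ (T := T)
    (fun q _ => lipschitzFlow_zero hK q) (fun q _ t _ => hasDerivAt_lipschitzFlow hK q t)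
    (fun _ _ _ _ => mem_univ _)
  exact h.contDiffAt ((isOpen_univ.prod isOpen_Ioo).mem_nhds hmem)

/-- A point where the field vanishes is fixed by the flow. [folklore] -/
theorem lipschitzFlow_eq_self_of_eq_zero (hK : LipschitzWith K g) {q : F} (hq : g q = 0)
    (t : ℝ) : lipschitzFlow hK q t = q := by
  have ht : t ∈ Ioo (-(|t| + 1)) (|t| + 1) := by
    constructor <;> cases abs_cases t <;> linarith
  have h := eqOn_lipschitzFlow hK (γ := fun _ => q) (a := -(|t| + 1)) (b := |t| + 1)
    ⟨by linarith [abs_nonneg t], by linarith [abs_nonneg t]⟩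
    (fun s _ => by simpa [hq] using hasDerivAt_const s q)
  exact (h ht).symm

/-- **The bounded case**: for a globally Lipschitz *bounded* field the flow `globalFlow` of
`CompactSupportFlow.lean` is the present one (uniqueness of integral curves). [cite: Lang1995, Ch. IV §1, Thm. 1.3] -/
theorem globalFlow_eq_lipschitzFlow (hK : LipschitzWith K g) {L : ℝ} (hL : ∀ q, ‖g q‖ ≤ L)
    (q : F) : globalFlow hK hL q = lipschitzFlow hK q := by
  funext t
  have ht : t ∈ Ioo (-(|t| + 1)) (|t| + 1) := by
    constructor <;> cases abs_cases t <;> linarith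
  have h := eqOn_lipschitzFlow hK (γ := globalFlow hK hL q) (a := -(|t| + 1)) (b := |t| + 1)
    ⟨by linarith [abs_nonneg t], by linarith [abs_nonneg t]⟩
    (fun s _ => hasDerivAt_globalFlow hK hL q s)
  have h2 := h ht
  rwa [globalFlow_zero] at h2

end Lipschitz

end Literature.Analysis.ODE
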